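import Summits.ResolutionOfSingularities.ResolutionOfSingularities.Theorems.FrobeniusLadderFInjectiveMacaulayficationProp44TauOneDescentDevice
import Summits.ResolutionOfSingularities.ResolutionOfSingularities.Theorems.MarkedTransferCampaignW46ThreefoldsTauTwoSlice
import Literature.AlgebraicGeometry.Resolution.BlowupsExistence
import Literature.AlgebraicGeometry.Resolution.CurveCentreNearPointGammaPrimeRegular
import HarnessLib

/-!
# [CoP1] Prop. 4.4 (`CossartPiltant2008_prop44`, F-71): the isolated `τ = 1` point slice BY DESCENT from the chain termination theorem T1,
# the curve step and the point step

[L1 W4.5a · crux `FInjectiveMacaulayfication` (stmt-ResolutionOfSingularities-15315); D-0154 (2) RES inputs cell, seat res-inputs-p-8a (gen 2);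
critic R51 (3) GO. PROVED assembly, no new named facts (D-0026): the three remaining inputs are ORACLE HYPOTHESES whose binder lists are the
cell's audited stub signatures — T1 = `stub_T1_false_of_nearChain_tau_one` (candidates `F71_T1_T4_SIGNATURES.lean` v4 l.340) and
STEP-P = the point step at an isolated `τ = 1` point (res-inputs-p-8a, next) — so that their provers' theorems instantiate them by `exact`;
Lemma 4.3 (4) for `Γ′` (T2b′) is the tree theorem `IsBlowup.isRegular_gammaPrime_of_isNear_curve` (res-inputs-p-6, p622153). Not a statement of the manuscript under adjudication. AI-written; AI review is weaker
than expert review.]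

* `exists_pending_of_curve` — THE CURVE LINEAGE: a curve instance which is not order-reducible carries a marked point and a pending chain
  of the descent (induction on the colength at the generic point; the step is p-8b's `exists_not_orderReducible_of_curve_step` /
  `curveData_of_isNear_generic`, Lemma 4.3 (4) for `Γ′` = `IsBlowup.isRegular_gammaPrime_of_isNear_curve`);
* `nonempty_next_of_point` — THE POINT STEP of the descent (oracle STEP-P: after blowing up an isolated `τ = 1` closed threefold point,
  either a near closed `τ = 1` point over it is bad, or the whole directrix line over it is; in the second case the curve lineage supplies
  the next stages);
* `orderReducible_comap_of_isolated_tau_one_of_descent` — **THE ISOLATED `τ = 1` POINT SLICE** (`stub_tauOne_point` of the patching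
  skeleton with the riders `hcodim` (critic R29) and — needed by the curve step and free at the skeleton's call site — `[IsIntegral X]
  [IsNoetherian X]`, quasi-excellence, `dim X ≤ 3`) **from the oracles T1 and STEP-P**: otherwise the descent never stops, and its marked
  points form an infinite consecutive chain of `τ = 1` near closed threefold points in the regime (*), forbidden by T1 (Cossart–Piltant 2008,
  proof of Prop. 4.4, p. 11: "we get a sequence of points `x_{σ(i)}` … a contradiction").

`CossartPiltant2008_prop44` is NOT proved (T1, STEP-P are hypotheses); resolution in dimension `≥ 4` / positive characteristic is NOT
proved.

References: V. Cossart, O. Piltant, J. Algebra 320 (2008), Lemma 4.3, Prop. 4.4 (proof, pp. 10–11), Lemma 4.5 [CossartPiltant2008];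
O. Piltant, RACSAM 107 (2013), Prop. 5.1 [Piltant2013].
-/

-- `Summit.<Summit>.<Sub>.Theorems` with `Sub = Summit` (single-conjunct summit, D-0017)
set_option linter.dupNamespace false

noncomputable section

open CategoryTheory CategoryTheory.Limits AlgebraicGeometry TopologicalSpace IsLocalRing
open Literature.AlgebraicGeometry.Resolution Scheme.IdealSheafData

namespace Summit.ResolutionOfSingularities.ResolutionOfSingularities.Theorems

namespace CP2008Prop44

universe u

/-! ## §3 The oracles, as hypotheses -/

section Oracles

variable {m : ℕ} (hm : 1 ≤ m)
  /- ORACLE STEP-P (the point step at an isolated `τ = 1` closed threefold point, Lemma 4.3 (1) (3) (5) at `τ = 1`; res-inputs-p-8a,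
  to be proved): after blowing up the point, either some near CLOSED `τ = 1` threefold point over it carries an instance which is not
  order-reducible, or the whole directrix line `L_x = cl{η′}` has order `m` and the instance over `π⁻¹W` along it is not
  order-reducible. -/
  (hP : ∀ ⦃X : Scheme.{u}⦄ [IsIntegral X] [IsNoetherian X] (hX : Scheme.IsRegular X) (_hqe : Scheme.IsQuasiExcellent X)
      (_hX3 : topologicalKrullDim X ≤ 3) (J : X.IdealSheafData) (_hle : ∀ z, idealOrder J z ≤ m)
      (_hcodim : ∀ z ∈ J.support, 1 < Order.coheight z) (W : X.Opens) (x : X) (_hxW : x ∈ W)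
      (hcl : IsClosed ({x} : Set X)) (_hbad : ∀ z : X, (m : ℕ∞) ≤ idealOrder J z → z = x ∨ z ∉ (W : Set X))
      (_hord : idealOrder J x = m) (_hdim : (maximalIdeal (X.presheaf.stalk x)).spanFinrank = 3)
      (_hτ : haveI := hX x; stalkTau J x m = 1)
      ⦃X' : Scheme.{u}⦄ (π : X' ⟶ X) (_hπ : IsBlowup π (vanishingIdeal ⟨{x}, hcl⟩))
      (_hnot : ¬ CampaignW46.OrderReducible (J.comap W.ι) m),
      (∃ (_ : IsIntegral X') (_ : IsNoetherian X') (hX' : Scheme.IsRegular X') (_ : Scheme.IsQuasiExcellent X')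
        (_ : topologicalKrullDim X' ≤ 3) (_ : ∀ z, idealOrder (controlledTransform π (vanishingIdeal ⟨{x}, hcl⟩) J m) z ≤ m)
        (_ : ∀ z ∈ (controlledTransform π (vanishingIdeal ⟨{x}, hcl⟩) J m).support, 1 < Order.coheight z)
        (x' : X') (_ : π x' = x) (_ : IsNear π (vanishingIdeal ⟨{x}, hcl⟩) J m x') (W' : X'.Opens) (_ : x' ∈ W')
        (_ : W' ≤ π ⁻¹ᵁ W) (_ : IsClosed ({x'} : Set X'))
        (_ : ∀ z : X', (m : ℕ∞) ≤ idealOrder (controlledTransform π (vanishingIdeal ⟨{x}, hcl⟩) J m) z → z = x' ∨ z ∉ (W' : Set X'))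
        (_ : idealOrder (controlledTransform π (vanishingIdeal ⟨{x}, hcl⟩) J m) x' = m)
        (_ : (maximalIdeal (X'.presheaf.stalk x')).spanFinrank = 3)
        (_ : haveI := hX' x'; stalkTau (controlledTransform π (vanishingIdeal ⟨{x}, hcl⟩) J m) x' m = 1)
        (_ : IsGRing (X'.presheaf.stalk x')),
        ¬ CampaignW46.OrderReducible ((controlledTransform π (vanishingIdeal ⟨{x}, hcl⟩) J m).comap W'.ι) m) ∨
      (∃ (_ : IsIntegral X') (_ : IsNoetherian X') (_ : Scheme.IsRegular X') (_ : Scheme.IsQuasiExcellent X')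
        (_ : topologicalKrullDim X' ≤ 3) (_ : ∀ z, idealOrder (controlledTransform π (vanishingIdeal ⟨{x}, hcl⟩) J m) z ≤ m)
        (_ : ∀ z ∈ (controlledTransform π (vanishingIdeal ⟨{x}, hcl⟩) J m).support, 1 < Order.coheight z)
        (η' : X') (_ : π η' = x) (_ : Order.coheight η' = 2)
        (_ : Scheme.IsRegular (vanishingIdeal (⟨closure {η'}, isClosed_closure⟩ : Closeds X')).subscheme)
        (_ : closure ({η'} : Set X') ⊆ ((π ⁻¹ᵁ W : X'.Opens) : Set X'))
        (_ : ∀ z : X', (m : ℕ∞) ≤ idealOrder (controlledTransform π (vanishingIdeal ⟨{x}, hcl⟩) J m) z →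
          z ∈ closure ({η'} : Set X') ∨ z ∉ ((π ⁻¹ᵁ W : X'.Opens) : Set X'))
        (_ : ∀ y ∈ closure ({η'} : Set X'), idealOrder (controlledTransform π (vanishingIdeal ⟨{x}, hcl⟩) J m) y = m),
        ¬ CampaignW46.OrderReducible ((controlledTransform π (vanishingIdeal ⟨{x}, hcl⟩) J m).comap (π ⁻¹ᵁ W).ι) m))

/-! ## §4 The curve lineage: pending chains over a curve instance -/

include hm in
/-- **THE CURVE LINEAGE.** A curve instance (stage base with centre `Y = cl{η}`, `codim η = 2`) which is not order-reducible admits a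
marked point and a pending chain of the descent starting at it: blow `Y` up; by the descent form of the curve step
(`exists_not_orderReducible_of_curve_step`, p-8b) either (A) a near closed `τ = 1` threefold point over a closed point of `Y` is bad —
mark its image on `Y` and stop there — or (B) the near curve `Γ′` over `Y` (regular, near, onto `Y`: p-6) is bad, with smaller colength at its generic
point (`curveData_of_isNear_generic`; Lemma 4.3 (4) for `Γ′` is the tree theorem `IsBlowup.isRegular_gammaPrime_of_isNear_curve`, p-6),
and we continue down the lineage by induction on the colength, marking on `Y` the image of the point marked on `Γ′`. [cite: CossartPiltant2008, Prop. 4.4 (proof, pp. 10–11), Lemma 4.3 (2) (4)] -/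
theorem exists_pending_of_curve (N : ℕ) : ∀ (b : TauOneBase.{u} m) (η : b.X)
    (_hYη : (b.Y : Set b.X) = closure {η}) (_hcoh : Order.coheight η = 2)
    (_hlen : Module.length (b.X.presheaf.stalk η) (b.X.presheaf.stalk η ⧸ stalkIdeal b.J η) < N),
    ∃ p : TauOnePt b, Nonempty (Pending (⟨b, p⟩ : TauOneStage.{u} m)) := by
  classical
  induction N with
  | zero =>
    intro b η _ _ hlen
    exact absurd hlen (by simp)
  | succ N ih =>
    intro b η hYη hcoh hlen
    haveI := b.integral
    haveI := b.noeth
    have hX : Scheme.IsRegular b.X := b.reg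
    obtain ⟨X', π, hπ⟩ := exists_isBlowup b.X (vanishingIdeal b.Y)
    rcases exists_not_orderReducible_of_curve_step hm hX b.qe b.dim3 b.J b.le b.codim b.W b.Y η hYη hcoh b.Yreg b.YW
        b.bad b.Yord π hπ b.notRed with
      ⟨hint', hnoeth', hX', hqe', hX3', hle', hcodim', x', hx'Y, -, hclx, hnear', W', hx'W', hW'V, hcl', hbad', hord', hdim',
        hτ', _, hnot'⟩ | ⟨η', hη'η, hnearη', hnot'⟩
    · -- case (A): a bad near closed `τ = 1` point `x'`; mark `π x'` on `Y` and stop at the point stage `x'`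
      haveI := hint'
      haveI := hnoeth'
      let b' : TauOneBase.{u} m :=
        { X := X', J := controlledTransform π (vanishingIdeal b.Y) b.J m, W := W', Y := ⟨{x'}, hcl'⟩, integral := hint',
          noeth := hnoeth', reg := hX', qe := hqe', dim3 := hX3', le := hle', codim := hcodim',
          YW := Set.singleton_subset_iff.mpr hx'W', Yirr := isIrreducible_singleton,
          Yreg := CampaignW46.isRegular_subscheme_vanishingIdeal_singleton hcl',
          Yord := fun z hz => by rw [Set.mem_singleton_iff.mp hz]; exact hord',
          bad := fun z hz => (hbad' z hz).imp (fun h => Set.mem_singleton_iff.mpr h) id, notRed := hnot' }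
      let t : TauOneStage.{u} m := ⟨b', ⟨x', Set.mem_singleton x', hcl', hdim', hτ'⟩⟩
      refine ⟨⟨π x', hx'Y, hclx, spanFinrank_eq_three_of_apply hπ hX hX' b.dim3 hdim',
        stalkTau_eq_one_of_isNear_curve hm hX b.dim3 hYη hcoh b.Yreg b.Yord hπ hx'Y hnear'⟩,
        ⟨Pending.cons t ⟨π, hπ, rfl, rfl, hnear'⟩ (Pending.last rfl)⟩⟩
    · -- case (B): the near curve `Γ' = cl{η'}` is bad; continue down the lineage
      haveI := hπ.isProper
      haveI : IsLocallyNoetherian X' := LocallyOfFiniteType.isLocallyNoetherian π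
      obtain ⟨hregΓ, hnearΓ, hontoΓ⟩ := IsBlowup.isRegular_gammaPrime_of_isNear_curve hX b.Yirr b.Yreg hπ hm b.Yord b.le
        (η' := η')
        (by rw [hη'η, ← hYη]) (by rw [hη'η]; exact hcoh) hnearη'
      obtain ⟨hint', hnoeth', hX', hqe', hX3', hle', hcodim', hcohη', hΓV, hbadΓ, hordΓ, hlt, -⟩ :=
        curveData_of_isNear_generic hm hX b.qe b.dim3 b.J b.le b.codim b.W b.Y η hYη hcoh b.Yreg b.YW b.bad b.Yord π hπ
          hη'η hnearη' hnearΓ hontoΓ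
      haveI := hint'
      haveI := hnoeth'
      let b' : TauOneBase.{u} m :=
        { X := X', J := controlledTransform π (vanishingIdeal b.Y) b.J m, W := π ⁻¹ᵁ b.W,
          Y := ⟨closure {η'}, isClosed_closure⟩, integral := hint', noeth := hnoeth', reg := hX', qe := hqe', dim3 := hX3',
          le := hle', codim := hcodim', YW := hΓV, Yirr := isIrreducible_singleton.closure, Yreg := hregΓ, Yord := hordΓ,
          bad := hbadΓ, notRed := hnot' }
      have hlen' : Module.length (X'.presheaf.stalk η')
          (X'.presheaf.stalk η' ⧸ stalkIdeal (controlledTransform π (vanishingIdeal b.Y) b.J m) η') < N := by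
        have h1 : Module.length (b.X.presheaf.stalk η) (b.X.presheaf.stalk η ⧸ stalkIdeal b.J η) ≤ N := by
          have h := hlen
          rw [Nat.cast_succ] at h
          exact (ENat.lt_add_one_iff (ENat.coe_ne_top N)).mp h
        exact lt_of_lt_of_le hlt h1
      obtain ⟨p, ⟨pend⟩⟩ := ih b' η' rfl hcohη' hlen'
      have hpx : π p.x ∈ (b.Y : Set b.X) := by
        rw [← hontoΓ]; exact Set.mem_image_of_mem _ p.xY
      refine ⟨⟨π p.x, hpx, isClosed_singleton_apply hπ p.closed, spanFinrank_eq_three_of_apply hπ hX hX' b.dim3 p.dim,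
        stalkTau_eq_one_of_isNear_curve hm hX b.dim3 hYη hcoh b.Yreg b.Yord hπ hpx (hnearΓ _ p.xY)⟩,
        ⟨Pending.cons ⟨b', p⟩ ⟨π, hπ, rfl, rfl, hnearΓ _ p.xY⟩ pend⟩⟩

/-! ## §5 The point step: the next stage after a point stage -/

include hm hP in
/-- **THE POINT STEP of the descent.** A stage whose centre is its marked (closed, `τ = 1`, threefold) point has a next stage: blow the
point up; by the oracle STEP-P either a near closed `τ = 1` point over it is bad (next stage = that point), or the directrix line over it
is bad (next stages = the curve lineage of `exists_pending_of_curve`, the marked point on the line being the image of its end).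
[cite: CossartPiltant2008, Prop. 4.4 (proof, p. 11), Lemma 4.5 (1)] -/
theorem nonempty_next_of_point (s : TauOneStage.{u} m) (hpt : (s.base.Y : Set s.base.X) = {s.pt.x}) :
    Nonempty (TauOneNext s) := by
  classical
  haveI := s.base.integral
  haveI := s.base.noeth
  have hX : Scheme.IsRegular s.base.X := s.base.reg
  have hYeq : s.base.Y = ⟨{s.pt.x}, s.pt.closed⟩ := TopologicalSpace.Closeds.ext hpt
  obtain ⟨X', π, hπ⟩ := exists_isBlowup s.base.X (vanishingIdeal (⟨{s.pt.x}, s.pt.closed⟩ : Closeds s.base.X))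
  have hbad : ∀ z : s.base.X, (m : ℕ∞) ≤ idealOrder s.base.J z → z = s.pt.x ∨ z ∉ (s.base.W : Set s.base.X) :=
    fun z hz => (s.base.bad z hz).imp (fun h => by rw [hpt] at h; exact h) id
  have hord : idealOrder s.base.J s.pt.x = m := s.base.Yord _ s.pt.xY
  have hxW : s.pt.x ∈ s.base.W := s.base.YW s.pt.xY
  rcases hP hX s.base.qe s.base.dim3 s.base.J s.base.le s.base.codim s.base.W s.pt.x hxW s.pt.closed hbad hord s.pt.dim
      s.pt.tau π hπ s.base.notRed with
    ⟨hint', hnoeth', hX', hqe', hX3', hle', hcodim', x', hx'x, hnear', W', hx'W', -, hcl', hbad', hord', hdim', hτ', -, hnot'⟩ |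
    ⟨hint', hnoeth', hX', hqe', hX3', hle', hcodim', η', hη'x, hcoh', hregL, hLW, hbadL, hordL, hnotL⟩
  · -- (P1): the next stage is the bad near point `x'`
    haveI := hint'
    haveI := hnoeth'
    let b' : TauOneBase.{u} m :=
      { X := X', J := controlledTransform π (vanishingIdeal (⟨{s.pt.x}, s.pt.closed⟩ : Closeds s.base.X)) s.base.J m, W := W',
        Y := ⟨{x'}, hcl'⟩, integral := hint', noeth := hnoeth', reg := hX', qe := hqe', dim3 := hX3', le := hle',
        codim := hcodim', YW := Set.singleton_subset_iff.mpr hx'W', Yirr := isIrreducible_singleton,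
        Yreg := CampaignW46.isRegular_subscheme_vanishingIdeal_singleton hcl',
        Yord := fun z hz => by rw [Set.mem_singleton_iff.mp hz]; exact hord',
        bad := fun z hz => (hbad' z hz).imp (fun h => Set.mem_singleton_iff.mpr h) id, notRed := hnot' }
    let t : TauOneStage.{u} m := ⟨b', ⟨x', Set.mem_singleton x', hcl', hdim', hτ'⟩⟩
    refine ⟨⟨t, ⟨π, ?_, ?_, hx'x, ?_⟩, Pending.last rfl⟩⟩
    · rw [hYeq]; exact hπ
    · change controlledTransform π _ s.base.J m = _
      rw [hYeq]
    · change IsNear π (vanishingIdeal s.base.Y) s.base.J m x'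
      rw [hYeq]; exact hnear'
  · -- (P2): the whole directrix line `L = cl{η'}` is bad; compute its lineage and mark the image of its end
    haveI := hint'
    haveI := hnoeth'
    let b' : TauOneBase.{u} m :=
      { X := X', J := controlledTransform π (vanishingIdeal (⟨{s.pt.x}, s.pt.closed⟩ : Closeds s.base.X)) s.base.J m,
        W := π ⁻¹ᵁ s.base.W, Y := ⟨closure {η'}, isClosed_closure⟩, integral := hint', noeth := hnoeth', reg := hX',
        qe := hqe', dim3 := hX3', le := hle', codim := hcodim', YW := hLW, Yirr := isIrreducible_singleton.closure,
        Yreg := hregL, Yord := hordL, bad := hbadL, notRed := hnotL }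
    -- the colength at the generic point of the line is finite
    have hη'supp : η' ∈ (controlledTransform π (vanishingIdeal (⟨{s.pt.x}, s.pt.closed⟩ : Closeds s.base.X)) s.base.J m).support := by
      rw [← one_le_idealOrder_iff, hordL η' (subset_closure rfl)]
      exact_mod_cast hm
    haveI := hX' η'
    have hmax := mem_maxPoints_support_of_coheight_eq_two hcodim' hη'supp hcoh'
    have hfin := length_quotient_stalkIdeal_ne_top_of_mem_maxPoints hmax
    obtain ⟨N, hN⟩ := ENat.ne_top_iff_exists.mp hfin
    have hlen : Module.length (X'.presheaf.stalk η') (X'.presheaf.stalk η' ⧸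
        stalkIdeal (controlledTransform π (vanishingIdeal (⟨{s.pt.x}, s.pt.closed⟩ : Closeds s.base.X)) s.base.J m) η') <
        (N + 1 : ℕ) := by
      rw [← hN]; exact_mod_cast Nat.lt_succ_self N
    obtain ⟨p, ⟨pend⟩⟩ := exists_pending_of_curve hm (N + 1) b' η' rfl hcoh' hlen
    have hpx : π p.x = s.pt.x := by
      have hsub : closure ({η'} : Set X') ⊆ π ⁻¹' {s.pt.x} :=
        closure_minimal (Set.singleton_subset_iff.mpr hη'x) (s.pt.closed.preimage π.continuous)
      exact hsub p.xY
    refine ⟨⟨⟨b', p⟩, ⟨π, ?_, ?_, hpx, ?_⟩, pend⟩⟩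
    · rw [hYeq]; exact hπ
    · change controlledTransform π _ s.base.J m = _
      rw [hYeq]
    · change IsNear π (vanishingIdeal s.base.Y) s.base.J m p.x
      rw [hYeq]; exact hordL _ p.xY

/-! ## §6 The descent: `stub_tauOne_point` from the oracles T1 and STEP-P -/

include hm hP in
/-- **THE ISOLATED `τ = 1` POINT SLICE BY DESCENT** (census S3 ⊇ T1; skeleton `stub_tauOne_point` with the riders `hcodim` (critic R29),
`[IsIntegral X] [IsNoetherian X]`, quasi-excellence and `dim X ≤ 3` — all available at its call site from `prop44Invariants_stage`):
GIVEN the chain termination theorem T1 (oracle `hT1` = `stub_T1_false_of_nearChain_tau_one`, SIGNATURES v4 l.340, binders verbatim: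
no infinite consecutive chain of `τ = 1` near closed threefold points under blowing ups of points and regular curves of the order-`m`
locus, in the regime (*)), Lemma 4.3 (4) for `Γ′` (tree theorem, p-6) and the point step (oracle `hP`), an isolated closed threefold point
`x ∈ V` of order `m` with `τ = 1` has `(V, J|_V, m)` ORDER-REDUCIBLE. Proof: otherwise the point step and the curve lineage never stop
(`nonempty_next_of_point`), and reading off the marked points of the resulting infinite descent gives a chain forbidden by T1.
[cite: CossartPiltant2008, Prop. 4.4 (proof, p. 11), Lemma 4.5] -/
theorem orderReducible_comap_of_isolated_tau_one_of_descent
    (hT1 : ∀ (Xs : ℕ → Scheme.{u}) (_hN : ∀ n, IsLocallyNoetherian (Xs n)) (hXreg : ∀ n, Scheme.IsRegular (Xs n))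
      (π : ∀ n, Xs (n + 1) ⟶ Xs n) (Y : ∀ n, Closeds (Xs n)) (y : ∀ n, Xs (n + 1))
      (J : ∀ n, (Xs n).IdealSheafData) ⦃μ : ℕ⦄ (_hμ : 1 ≤ μ)
      (_hy : ∀ n, π (n + 1) (y (n + 1)) = y n)
      (_hmem : ∀ n, π n (y n) ∈ (Y n : Set (Xs n)))
      (_hcl : ∀ n, IsClosed ({π n (y n)} : Set (Xs n)))
      (_hYirr : ∀ n, IsIrreducible ((Y n : Closeds (Xs n)) : Set (Xs n)))
      (_hYreg : ∀ n, Scheme.IsRegular (vanishingIdeal (Y n)).subscheme)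
      (_hYord : ∀ n, ∀ z ∈ (Y n : Set (Xs n)), idealOrder (J n) z = μ)
      (_hπ : ∀ n, IsBlowup (π n) (vanishingIdeal (Y n)))
      (_hJ : ∀ n, J (n + 1) = controlledTransform (π n) (vanishingIdeal (Y n)) (J n) μ)
      (_hbd : ∀ n (z : Xs n), idealOrder (J n) z ≤ μ)
      (_hcodim : ∀ n, ∀ z ∈ (J n).support, 1 < Order.coheight z)
      (_hd : ∀ n, (maximalIdeal ((Xs n).presheaf.stalk (π n (y n)))).spanFinrank = 3)
      (_hnear : ∀ n, IsNear (π n) (vanishingIdeal (Y n)) (J n) μ (y n))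
      (_hτ : ∀ n, @stalkTau (Xs n) (J n) (π n (y n)) (hXreg n (π n (y n))) μ = 1)
      (_hG : ∀ n, IsGRing ((Xs n).presheaf.stalk (π n (y n))))
      (_hcoinc : ∀ n (z : Xs n), z ⤳ π n (y n) → idealOrder (J n) z = μ → z ∈ (Y n : Set (Xs n))),
      False)
    {X : Scheme.{u}} [IsIntegral X] [IsNoetherian X] (hX : Scheme.IsRegular X) (hqe : Scheme.IsQuasiExcellent X)
    (hX3 : topologicalKrullDim X ≤ 3) (J : X.IdealSheafData) (hle : ∀ z, idealOrder J z ≤ m)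
    (hcodim : ∀ z ∈ J.support, 1 < Order.coheight z) (V : X.Opens) (x : X) (hxV : x ∈ V)
    (hcl : IsClosed ({x} : Set X)) (hbad : ∀ z : X, (m : ℕ∞) ≤ idealOrder J z → z = x ∨ z ∉ (V : Set X))
    (hord : idealOrder J x = m) (hdim : (maximalIdeal (X.presheaf.stalk x)).spanFinrank = 3)
    (hτ : haveI := hX x; stalkTau J x m = 1) (_hG : IsGRing (X.presheaf.stalk x)) :
    CampaignW46.OrderReducible (J.comap V.ι) m := by
  classical
  by_contra hnot
  -- the initial point stage
  let b₀ : TauOneBase.{u} m :=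
    { X := X, J := J, W := V, Y := ⟨{x}, hcl⟩, integral := inferInstance, noeth := inferInstance, reg := hX, qe := hqe,
      dim3 := hX3, le := hle, codim := hcodim, YW := Set.singleton_subset_iff.mpr hxV, Yirr := isIrreducible_singleton,
      Yreg := CampaignW46.isRegular_subscheme_vanishingIdeal_singleton hcl,
      Yord := fun z hz => by rw [Set.mem_singleton_iff.mp hz]; exact hord,
      bad := fun z hz => (hbad z hz).imp (fun h => Set.mem_singleton_iff.mpr h) id, notRed := hnot }
  let s₀ : TauOneStage.{u} m := ⟨b₀, ⟨x, Set.mem_singleton x, hcl, hdim, hτ⟩⟩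
  let st₀ : (s : TauOneStage.{u} m) × Pending s := ⟨s₀, Pending.last rfl⟩
  -- one step of the descent: read off the pending chain, or compute the next point step
  let step : ∀ sp : (s : TauOneStage.{u} m) × Pending s, (t : TauOneStage.{u} m) × TauOneLink sp.1 t × Pending t :=
    fun sp => Pending.casesOn (motive := fun s _ => (t : TauOneStage.{u} m) × TauOneLink s t × Pending t) sp.2
      (fun {s} hpt =>
        let nx : TauOneNext s := Classical.choice (nonempty_next_of_point hm hP s hpt)
        ⟨nx.t, nx.link, nx.rest⟩)
      (fun {s} t l rest => ⟨t, l, rest⟩)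
  let chain : ℕ → (s : TauOneStage.{u} m) × Pending s :=
    fun n => Nat.rec st₀ (fun _ sp => ⟨(step sp).1, (step sp).2.2⟩) n
  -- the data of the chain
  let Xs : ℕ → Scheme.{u} := fun n => (chain n).1.base.X
  let πs : ∀ n, Xs (n + 1) ⟶ Xs n := fun n => (step (chain n)).2.1.π
  let Ys : ∀ n, Closeds (Xs n) := fun n => (chain n).1.base.Y
  let ys : ∀ n, Xs (n + 1) := fun n => (chain (n + 1)).1.pt.x
  let Js : ∀ n, (Xs n).IdealSheafData := fun n => (chain n).1.base.J
  have hreg : ∀ n, Scheme.IsRegular (Xs n) := fun n => (chain n).1.base.reg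
  haveI : ∀ n, IsNoetherian (Xs n) := fun n => (chain n).1.base.noeth
  have e : ∀ n, πs n (ys n) = (chain n).1.pt.x := fun n => (step (chain n)).2.1.apply_x
  refine hT1 Xs (fun n => inferInstance) hreg πs Ys ys Js hm (fun n => e (n + 1)) (fun n => ?_) (fun n => ?_)
    (fun n => (chain n).1.base.Yirr) (fun n => (chain n).1.base.Yreg) (fun n => (chain n).1.base.Yord)
    (fun n => (step (chain n)).2.1.blowup) (fun n => (step (chain n)).2.1.transform) (fun n => (chain n).1.base.le)
    (fun n => (chain n).1.base.codim) (fun n => ?_) (fun n => (step (chain n)).2.1.near) (fun n => ?_) (fun n => ?_)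
    (fun n z hz hzord => ?_)
  · -- `x_n ∈ Y_n`
    rw [e n]; exact (chain n).1.pt.xY
  · -- `x_n` is closed
    rw [e n]; exact (chain n).1.pt.closed
  · -- embedding dimension `3`
    rw [CampaignW46.spanFinrank_maximalIdeal_congr (e n)]; exact (chain n).1.pt.dim
  · -- `τ(x_n) = 1`
    rw [CampaignW46.stalkTau_congr (hreg n) (Js n) m (e n)]; exact (chain n).1.pt.tau
  · -- G-ring
    exact CampaignW46.isGRing_stalk_congr (e n).symm
      (Scheme.isGRing_stalk_of_isQuasiExcellent (chain n).1.base.qe _)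
  · -- the regime (*): a generization of `x_n` of order `m` lies in `W_n`, hence on `Y_n`
    rw [e n] at hz
    have hzW : z ∈ ((chain n).1.base.W : Set (Xs n)) :=
      hz.mem_open (chain n).1.base.W.2 ((chain n).1.base.YW (chain n).1.pt.xY)
    rcases (chain n).1.base.bad z hzord.ge with h | h
    · exact h
    · exact absurd hzW h

end Oracles

end CP2008Prop44

end Summit.ResolutionOfSingularities.ResolutionOfSingularities.Theorems

end
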